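import Literature.Computability.AlgebraicComplexity.MW21SymmetryTypes
import Literature.Computability.AlgebraicComplexity.MW21NcRankTransposeProofs
import HarnessLib

/-!
# Makam–Wigderson 2021, Thms. 1.13 and 1.14 PROVED: the symmetry groups of `SING_{n,m}` and
# `NSING_{n,m}` are `G_{n,m} ∪ G_{n,m}·τ`; hence the cores of Thms. 1.9 and 1.8

Sibling proof file of `Literature/Computability/AlgebraicComplexity/MW21SingularTuplesNullCone.lean`
(cell `val-lit`, cross-ladder typing row X3-MW21). It discharges the named facts
`makamWigderson2021_thm_1_13` and `makamWigderson2021_thm_1_14` of that file (V. Makam,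
A. Wigderson, *Singular tuples of matrices is not a null cone (and the symmetries of algebraic
varieties)*, J. reine angew. Math. **780** (2021) = arXiv:1909.00857, Thms. 1.13/1.14, proved there in
§9), and through the tree's reductions (`MW21NcRankTransposeProofs`) the cores of Thms. 1.9 and 1.8
(`makamWigderson2021_thm_1_9_core_holds`, `makamWigderson2021_thm_1_8_core_holds`).

## Route (disclosed deviation from the printed proof)

The paper computes `𝒢_S` through its Lie algebra (§9: `Lie(𝒢_S) ⊆` the derivations preserving the
ideal of `S`, then a weight computation). Mathlib has no algebraic-group/Lie-algebra dictionary, so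
this file follows the classical *linear preserver* road instead (Dieudonné 1949 / Flanders 1962 for
the maximal singular subspaces, then a Marcus–Moyls-type rank-one preserver argument), entirely in
linear algebra, using the three sibling files

* `Literature/LinearAlgebra/DieudonneSingularSubspaces.lean` — subspaces of singular matrices of
  dimension `n(n-1)` are `K_v = {A | Av = 0}` or `K^w = {A | wᵀA = 0}`;
* `MW21SingMaximalSubspaces.lean` — the linear subspaces of `SING_{n,m}` / `NSING_{n,m}` of dimension
  `m·n(n-1)` are exactly `ℂ^m ⊗ K_v` and `ℂ^m ⊗ K^w`;
* `MW21SymmetryTypes.lean` — a linear symmetry `e` of `SING`/`NSING` permutes these maximal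
  subspaces, hence is *type-preserving* or *type-swapping* (step C), and a type-preserving `e` maps
  column types `C_a = ℂ^m ⊗ a ⊗ ℂⁿ` to column types `C_{α(a)}`, row types `D_b` to `D_{β(b)}`, and
  rank-one planes `ℂ^m ⊗ ℂabᵀ = C_a ∩ D_b` to rank-one planes (step D1).

This file finishes the argument:

* **D2 (`exists_linear_of_map_tupleOf_span`, `exists_Lfamily`)**: on each rank-one plane,
  `e(c ⊗ abᵀ) = L_{ab}(c) ⊗ α(a)β(b)ᵀ` with `L_{ab} ∈ GL_m` linear.
* **D3 (`exists_eq_smul_row/col(_all)`, `exists_tensor_decomposition`)**: expanding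
  `e(c ⊗ a(b₁+b₂)ᵀ)` and contracting the column factor shows `L_{ab₁} ∝ L_{ab₂}` (for `b₁ ∦ b₂` by
  independence of `β(b₁), β(b₂)`; a parallel pair is joined through a third direction, `n ≥ 2`), and
  symmetrically in `a`; so all `L_{ab} = ν(a,b)·L` and `e = L ⊗ h` with `h` linear injective on
  `M_n(ℂ)`, `h(abᵀ) ∈ ℂ α(a)β(b)ᵀ`.
* **D4 (`exists_eq_mul_mul_transpose`)**: such a two-sided rank-one preserver is `A ↦ UAWᵀ`
  (`U, W ∈ GL_n`): the maps `a ↦ h(abᵀ)y_b` are injective, pointwise proportional to `α`, hence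
  proportional to each other (`exists_eq_smul_of_forall_apply_mem`), which linearises the labels.
* **Assembly (`mem_G_of_typePreserving`, `typePreserving_mul_tau`)**: `g = (L, U, W)·` is
  `tripleAct`, i.e. `g ∈ G_{n,m}`; a type-swapping `g` has type-preserving `gτ`. The cases `n = 1`
  and the easy inclusions are the tree's (`thm_1_13_of_n_eq_one`, `mem_symmetryGroup_SING_of_mem_G_or`,
  and the `NSING` analogues).

No new definitions, no new named facts. Honest framing: these are statements about the symmetry
groups of two explicit varieties; nothing here bears on VP versus VNP beyond closing the MW21
null-cone chain of the typing row.

## References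

* [MakamWigderson2021] V. Makam, A. Wigderson, J. reine angew. Math. 780 (2021), 79–131
  (arXiv:1909.00857), Thms. 1.8, 1.9, 1.13, 1.14, §9.
* [Dieudonne1948] J. Dieudonné, Arch. Math. 1 (1949), 282–287.
* [Flanders1962] H. Flanders, J. London Math. Soc. 37 (1962), 10–16.
-/

noncomputable section

open Module Matrix

namespace Literature.Computability.AlgebraicComplexity

namespace MakamWigderson

variable {n m : ℕ}

/-! ### Small linear-algebra helpers -/

/-- A nonzero vector `u` has a partner `y` with `u · y = 1`. [cite: MakamWigderson2021, Thm 1.13 (proof, elementary route: linear algebra step)] -/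
theorem exists_dotProduct_eq_one {u : Fin n → ℂ} (hu : u ≠ 0) : ∃ y : Fin n → ℂ, u ⬝ᵥ y = 1 := by
  obtain ⟨j, hj⟩ := Function.ne_iff.1 hu
  exact ⟨Pi.single j (u j)⁻¹, by rw [dotProduct_single, mul_inv_cancel₀ hj]⟩

/-- A nonzero vector `u` has a partner `x` with `x · u = 1`. [cite: MakamWigderson2021, Thm 1.13 (proof, elementary route: linear algebra step)] -/
theorem exists_dotProduct_eq_one' {u : Fin n → ℂ} (hu : u ≠ 0) : ∃ x : Fin n → ℂ, x ⬝ᵥ u = 1 := by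
  obtain ⟨j, hj⟩ := Function.ne_iff.1 hu
  exact ⟨Pi.single j (u j)⁻¹, by rw [single_dotProduct, inv_mul_cancel₀ hj]⟩

/-- Two vectors `u ∉ ℂv`, `v ≠ 0` are linearly independent (coefficient form).
[cite: MakamWigderson2021, Thm 1.13 (proof, elementary route: linear algebra step)] -/
theorem pair_indep {W : Type*} [AddCommGroup W] [Module ℂ W] {u v : W} (hv : v ≠ 0)
    (hu : u ∉ (ℂ ∙ v)) (s t : ℂ) (h : s • u + t • v = 0) : s = 0 ∧ t = 0 := by
  by_cases hs : s = 0
  · subst hs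
    rw [zero_smul, zero_add] at h
    exact ⟨rfl, (smul_eq_zero.1 h).resolve_right hv⟩
  · exfalso
    apply hu
    rw [Submodule.mem_span_singleton]
    refine ⟨-(s⁻¹ * t), ?_⟩
    have h' : s⁻¹ • (s • u + t • v) = 0 := by rw [h, smul_zero]
    rw [smul_add, smul_smul, inv_mul_cancel₀ hs, one_smul, smul_smul] at h'
    rw [neg_smul, (eq_neg_of_add_eq_zero_left h').symm]

/-- Non-parallelism of nonzero vectors is symmetric. [cite: MakamWigderson2021, Thm 1.13 (proof, elementary route: linear algebra step)] -/
theorem not_mem_span_symm {W : Type*} [AddCommGroup W] [Module ℂ W] {u v : W} (hu : u ≠ 0)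
    (h : v ∉ (ℂ ∙ u)) : u ∉ (ℂ ∙ v) := by
  intro hmem
  obtain ⟨t, rfl⟩ := Submodule.mem_span_singleton.1 hmem
  have ht : t ≠ 0 := by rintro rfl; exact hu (zero_smul _ _)
  exact h (Submodule.mem_span_singleton.2 ⟨t⁻¹, by rw [smul_smul, inv_mul_cancel₀ ht, one_smul]⟩)

/-- In dimension `n ≥ 2` no line is everything. [cite: MakamWigderson2021, Thm 1.13 (proof, elementary route: linear algebra step)] -/
theorem exists_not_mem_span (hn : 2 ≤ n) (v : Fin n → ℂ) : ∃ u : Fin n → ℂ, u ∉ (ℂ ∙ v) := by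
  by_contra h
  have h' : ∀ u : Fin n → ℂ, u ∈ (ℂ ∙ v) := fun u => of_not_not (not_exists.1 h u)
  have hle : (⊤ : Submodule ℂ (Fin n → ℂ)) ≤ ℂ ∙ v := fun u _ => h' u
  have h1 : finrank ℂ (Fin n → ℂ) ≤ finrank ℂ (ℂ ∙ v) := by
    rw [← finrank_top ℂ (Fin n → ℂ)]; exact Submodule.finrank_mono hle
  rw [finrank_fin_fun] at h1
  by_cases hv : v = 0
  · subst hv
    rw [Submodule.span_zero_singleton, finrank_bot] at h1
    omega
  · rw [finrank_span_singleton hv] at h1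
    omega

/-- `(uvᵀ) y = (v·y) u`. [cite: MakamWigderson2021, Thm 1.13 (proof, elementary route: linear algebra step)] -/
theorem vecMulVec_mulVec_eq_smul (u v y : Fin n → ℂ) : vecMulVec u v *ᵥ y = (v ⬝ᵥ y) • u := by
  rw [← transpose_vecMulVec, mulVec_transpose, vecMul_vecMulVec, dotProduct_comm]

/-- **Proportionality of linear maps.** If `S` is injective and `T x ∈ ℂ·S x` for every `x`, then
`T = t·S` for one scalar `t`. [cite: MakamWigderson2021, Thm 1.13 (proof, elementary route: linear algebra step)] -/
theorem exists_eq_smul_of_forall_apply_mem {V W : Type*} [AddCommGroup V] [Module ℂ V]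
    [AddCommGroup W] [Module ℂ W] (S T : V →ₗ[ℂ] W) (hS : Function.Injective S)
    (h : ∀ x, ∃ t : ℂ, T x = t • S x) : ∃ t : ℂ, T = t • S := by
  by_cases hV : ∃ x : V, x ≠ 0
  swap
  · have hV' : ∀ x : V, x = 0 := fun x => of_not_not (not_exists.1 hV x)
    exact ⟨0, LinearMap.ext fun x => by rw [hV' x, map_zero, map_zero]⟩
  obtain ⟨x₀, hx₀⟩ := hV
  obtain ⟨t₀, ht₀⟩ := h x₀
  have hSx₀ : S x₀ ≠ 0 := fun h0 => hx₀ (hS (by rw [h0, map_zero]))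
  refine ⟨t₀, LinearMap.ext fun x => ?_⟩
  rw [LinearMap.smul_apply]
  obtain ⟨tx, htx⟩ := h x
  obtain ⟨t₁, ht₁⟩ := h (x + x₀)
  rw [map_add, map_add, htx, ht₀, smul_add] at ht₁
  by_cases hind : S x ∈ (ℂ ∙ S x₀)
  · obtain ⟨r, hr⟩ := Submodule.mem_span_singleton.1 hind
    have hx : x = r • x₀ := hS (by rw [map_smul, hr])
    rw [hx, map_smul, ht₀, map_smul, smul_comm]
  · have h0 : (tx - t₁) • S x + (t₀ - t₁) • S x₀ = 0 := by
      rw [sub_smul, sub_smul]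
      have := sub_eq_zero.2 ht₁
      rw [← this]; abel
    obtain ⟨h1, h2⟩ := pair_indep hSx₀ hind _ _ h0
    rw [htx, show tx = t₀ by rw [sub_eq_zero.1 h1, sub_eq_zero.1 h2]]

/-- **Coefficient comparison.** From `L₃(c)ᵢ u₃ = L₁(c)ᵢ u₁ + L₂(c)ᵢ u₂` for all `c, i`, with
`u₁ ∉ ℂu₂` and `L₂, L₃` injective (`m ≥ 1`), the maps `L₁, L₂` are proportional.
[cite: MakamWigderson2021, Thm 1.13 (proof, elementary route: linear algebra step)] -/
theorem exists_eq_smul_of_identity (hm : 1 ≤ m) {W : Type*} [AddCommGroup W] [Module ℂ W]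
    {L₁ L₂ L₃ : (Fin m → ℂ) →ₗ[ℂ] (Fin m → ℂ)}
    (h₂ : Function.Injective L₂) (h₃ : Function.Injective L₃) {u₁ u₂ u₃ : W}
    (hu₂ : u₂ ≠ 0) (h12 : u₁ ∉ (ℂ ∙ u₂))
    (hid : ∀ (c : Fin m → ℂ) (i : Fin m), L₃ c i • u₃ = L₁ c i • u₁ + L₂ c i • u₂) :
    ∃ r : ℂ, L₁ = r • L₂ := by
  set c₀ : Fin m → ℂ := fun _ => 1 with hc₀
  have hc₀ne : c₀ ≠ 0 := fun h => one_ne_zero (congrFun h ⟨0, hm⟩)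
  have hL3 : L₃ c₀ ≠ 0 := fun h => hc₀ne (h₃ (by rw [h, map_zero]))
  obtain ⟨i₀, hi₀⟩ := Function.ne_iff.1 hL3
  set s : ℂ := (L₃ c₀ i₀)⁻¹ * L₁ c₀ i₀ with hs
  set t : ℂ := (L₃ c₀ i₀)⁻¹ * L₂ c₀ i₀ with ht
  have hu₃ : u₃ = s • u₁ + t • u₂ := by
    have h' : u₃ = (L₃ c₀ i₀)⁻¹ • (L₃ c₀ i₀ • u₃) := by
      rw [smul_smul, inv_mul_cancel₀ hi₀, one_smul]
    rw [h', hid c₀ i₀, smul_add, smul_smul, smul_smul]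
  have hcoef : ∀ c i, L₁ c i = s * L₃ c i ∧ L₂ c i = t * L₃ c i := by
    intro c i
    have hci := hid c i
    rw [hu₃, smul_add, smul_smul, smul_smul] at hci
    have h0 : (L₁ c i - L₃ c i * s) • u₁ + (L₂ c i - L₃ c i * t) • u₂ = 0 := by
      rw [sub_smul, sub_smul]
      have := sub_eq_zero.2 hci.symm
      rw [← this]; abel
    obtain ⟨h1, h2⟩ := pair_indep hu₂ h12 _ _ h0
    constructor
    · rw [sub_eq_zero.1 h1, mul_comm]
    · rw [sub_eq_zero.1 h2, mul_comm]
  have ht0 : t ≠ 0 := by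
    intro ht0
    have : L₂ c₀ = 0 := funext fun i => by rw [(hcoef c₀ i).2, ht0, zero_mul]; rfl
    exact hc₀ne (h₂ (by rw [this, map_zero]))
  refine ⟨s * t⁻¹, LinearMap.ext fun c => funext fun i => ?_⟩
  rw [LinearMap.smul_apply, Pi.smul_apply, smul_eq_mul, (hcoef c i).1, (hcoef c i).2,
    mul_assoc s t⁻¹ (t * L₃ c i), inv_mul_cancel_left₀ ht0]

/-- A coordinate functional along a nonzero matrix. [cite: MakamWigderson2021, Thm 1.13 (proof, elementary route: linear algebra step)] -/
theorem exists_coord {E : Matrix (Fin n) (Fin n) ℂ} (hE : E ≠ 0) :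
    ∃ κ : Matrix (Fin n) (Fin n) ℂ →ₗ[ℂ] ℂ, ∀ Y ∈ (ℂ ∙ E), Y = κ Y • E := by
  obtain ⟨k, hk⟩ := Function.ne_iff.1 hE
  obtain ⟨l, hl⟩ := Function.ne_iff.1 hk
  refine ⟨(E k l)⁻¹ • Matrix.entryLinearMap ℂ ℂ k l, fun Y hY => ?_⟩
  obtain ⟨t, rfl⟩ := Submodule.mem_span_singleton.1 hY
  rw [LinearMap.smul_apply, Matrix.entryLinearMap_apply, Matrix.smul_apply, smul_eq_mul, smul_eq_mul,
    mul_comm t (E k l), inv_mul_cancel_left₀ hl]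

/-- Pure tensors `c ⊗ E` (`E ≠ 0`) determine `c`. [cite: MakamWigderson2021, Thm 1.13 (proof, elementary route: linear algebra step)] -/
theorem smulTuple_injective {E : Matrix (Fin n) (Fin n) ℂ} (hE : E ≠ 0) {c c' : Fin m → ℂ}
    (h : (fun i => c i • E) = fun i => c' i • E) : c = c' :=
  funext fun i => smul_left_injective ℂ hE (congrFun h i)

/-- **L-extraction.** If `e` maps `ℂ^m ⊗ ℂE` onto `ℂ^m ⊗ ℂE'` (`E, E' ≠ 0`), then
`e(c ⊗ E) = L(c) ⊗ E'` for an injective linear `L : ℂ^m → ℂ^m`.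
[cite: MakamWigderson2021, Thm 1.13 (proof, elementary route: linear algebra step)] -/
theorem exists_linear_of_map_tupleOf_span (e : Tuple n m ≃ₗ[ℂ] Tuple n m)
    {E E' : Matrix (Fin n) (Fin n) ℂ} (hE : E ≠ 0) (hE' : E' ≠ 0)
    (hmap : (tupleOf (m := m) (ℂ ∙ E)).map (e : Tuple n m →ₗ[ℂ] Tuple n m) = tupleOf (ℂ ∙ E')) :
    ∃ L : (Fin m → ℂ) →ₗ[ℂ] (Fin m → ℂ), Function.Injective L ∧
      ∀ c : Fin m → ℂ, e (fun i => c i • E) = fun i => L c i • E' := by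
  classical
  obtain ⟨κ, hκ⟩ := exists_coord hE'
  have himg : ∀ c : Fin m → ℂ, ∀ i, e (fun j => c j • E) i ∈ (ℂ ∙ E') := by
    intro c
    have hX : (fun j => c j • E) ∈ tupleOf (m := m) (ℂ ∙ E) :=
      fun j => Submodule.smul_mem _ _ (Submodule.mem_span_singleton_self E)
    have h1 : e (fun j => c j • E) ∈
        (tupleOf (m := m) (ℂ ∙ E)).map (e : Tuple n m →ₗ[ℂ] Tuple n m) := ⟨_, hX, rfl⟩
    rw [hmap] at h1
    exact h1
  have hadd : ∀ c c' : Fin m → ℂ,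
      (fun j => (c + c') j • E) = (fun j => c j • E) + fun j => c' j • E := by
    intro c c'; funext j; simp [add_smul]
  have hsmul : ∀ (t : ℂ) (c : Fin m → ℂ),
      (fun j => (t • c) j • E) = t • fun j => c j • E := by
    intro t c; funext j; simp [mul_smul]
  let L : (Fin m → ℂ) →ₗ[ℂ] (Fin m → ℂ) :=
    { toFun := fun c i => κ (e (fun j => c j • E) i)
      map_add' := fun c c' => by
        funext i
        rw [hadd, map_add]
        simp only [Pi.add_apply, map_add]
      map_smul' := fun t c => by
        funext i
        rw [hsmul, map_smul]
        simp only [Pi.smul_apply, map_smul, RingHom.id_apply] }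
  have hL : ∀ c i, L c i = κ (e (fun j => c j • E) i) := fun c i => rfl
  have hformula : ∀ c : Fin m → ℂ, e (fun i => c i • E) = fun i => L c i • E' :=
    fun c => funext fun i => by rw [hL]; exact hκ _ (himg c i)
  refine ⟨L, ?_, hformula⟩
  rw [injective_iff_map_eq_zero]
  intro c hc
  have h0 : e (fun j => c j • E) = 0 := by
    rw [hformula c]; funext i; rw [hc]; simp
  rw [e.map_eq_zero_iff] at h0
  funext j
  exact (smul_eq_zero.1 (congrFun h0 j)).resolve_right hE

/-- Two linear maps on `M_n(ℂ)` that agree on the rank-one matrices `abᵀ` (`a, b ≠ 0`) agree.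
[cite: MakamWigderson2021, Thm 1.13 (proof, elementary route: linear algebra step)] -/
theorem eq_of_eq_on_vecMulVec {W : Type*} [AddCommGroup W] [Module ℂ W]
    (F G : Matrix (Fin n) (Fin n) ℂ →ₗ[ℂ] W)
    (h : ∀ a b : Fin n → ℂ, a ≠ 0 → b ≠ 0 → F (vecMulVec a b) = G (vecMulVec a b)) : F = G := by
  classical
  apply LinearMap.ext
  intro A
  rw [matrix_eq_sum_single A]
  simp only [map_sum]
  refine Finset.sum_congr rfl fun i _ => Finset.sum_congr rfl fun j _ => ?_
  have hs : single i j (A i j) = A i j • vecMulVec (Pi.single i (1 : ℂ)) (Pi.single j 1) := by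
    rw [← single_eq_single_vecMulVec_single, smul_single, smul_eq_mul, mul_one]
  rw [hs, map_smul, map_smul, h _ _ (Pi.single_ne_zero_iff.2 one_ne_zero)
    (Pi.single_ne_zero_iff.2 one_ne_zero)]

/-! ### Labels, rank-one planes and the `L`-family of a type-preserving automorphism -/

section Extraction

variable (e : Tuple n m ≃ₗ[ℂ] Tuple n m)

/-- Choice of labels: total functions `α, β` on `ℂⁿ` with `e(C_a) = C_{α a}` and `e(D_b) = D_{β b}`
for all nonzero `a, b`. [cite: MakamWigderson2021, Thm 1.13 (proof, elementary route: step D1)] -/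
theorem exists_labels (hm : 1 ≤ m) (hn : 1 ≤ n) (hTP : TypePreserving e) :
    ∃ α β : (Fin n → ℂ) → (Fin n → ℂ),
      (∀ a, a ≠ 0 → α a ≠ 0 ∧
        (colType m a).map (e : Tuple n m →ₗ[ℂ] Tuple n m) = colType m (α a)) ∧
      (∀ b, b ≠ 0 → β b ≠ 0 ∧
        (rowType m b).map (e : Tuple n m →ₗ[ℂ] Tuple n m) = rowType m (β b)) := by
  classical
  have hA := fun (a : Fin n → ℂ) (ha : a ≠ 0) => exists_map_colType_eq e hm hn hTP.2 ha
  have hB := fun (b : Fin n → ℂ) (hb : b ≠ 0) => exists_map_rowType_eq e hm hn hTP.1 hb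
  choose α hα0 hα using hA
  choose β hβ0 hβ using hB
  refine ⟨fun a => if ha : a = 0 then 0 else α a ha, fun b => if hb : b = 0 then 0 else β b hb,
    fun a ha => ?_, fun b hb => ?_⟩
  · simp only [dif_neg ha]; exact ⟨hα0 a ha, hα a ha⟩
  · simp only [dif_neg hb]; exact ⟨hβ0 b hb, hβ b hb⟩

/-- `C_{a₁} = C_{a₂}` forces `a₁ ∈ ℂa₂` (`m, n ≥ 1`). [cite: MakamWigderson2021, Thm 1.13 (proof, elementary route: step D1)] -/
theorem mem_span_of_colType_eq (hm : 1 ≤ m) (hn : 1 ≤ n) {a₁ a₂ : Fin n → ℂ}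
    (h : colType m a₁ = colType m a₂) : a₁ ∈ (ℂ ∙ a₂) := by
  have hle : colIn (ℂ ∙ a₁) ≤ colIn (ℂ ∙ a₂) := le_of_tupleOf_le hm h.le
  have hA : (Matrix.of fun i (_ : Fin n) => a₁ i) ∈ colIn (ℂ ∙ a₁) :=
    fun _ => Submodule.mem_span_singleton_self a₁
  exact hle hA ⟨0, hn⟩

/-- `D_{b₁} = D_{b₂}` forces `b₁ ∈ ℂb₂` (`m, n ≥ 1`). [cite: MakamWigderson2021, Thm 1.13 (proof, elementary route: step D1)] -/
theorem mem_span_of_rowType_eq (hm : 1 ≤ m) (hn : 1 ≤ n) {b₁ b₂ : Fin n → ℂ}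
    (h : rowType m b₁ = rowType m b₂) : b₁ ∈ (ℂ ∙ b₂) := by
  have hle : rowIn (ℂ ∙ b₁) ≤ rowIn (ℂ ∙ b₂) := le_of_tupleOf_le hm h.le
  have hA : (Matrix.of fun (_ : Fin n) j => b₁ j) ∈ rowIn (ℂ ∙ b₁) :=
    fun _ => Submodule.mem_span_singleton_self b₁
  exact hle hA ⟨0, hn⟩

variable {e}

/-- The column label separates lines: `a₁ ∉ ℂa₂ ⇒ α a₁ ∉ ℂ α a₂`. [cite: MakamWigderson2021, Thm 1.13 (proof, elementary route: step D1)] -/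
theorem label_not_mem_span_col (hm : 1 ≤ m) (hn : 1 ≤ n) {α : (Fin n → ℂ) → (Fin n → ℂ)}
    (Hα : ∀ a, a ≠ 0 → α a ≠ 0 ∧
      (colType m a).map (e : Tuple n m →ₗ[ℂ] Tuple n m) = colType m (α a))
    {a₁ a₂ : Fin n → ℂ} (ha₁ : a₁ ≠ 0) (ha₂ : a₂ ≠ 0) (h12 : a₁ ∉ (ℂ ∙ a₂)) :
    α a₁ ∉ (ℂ ∙ α a₂) := by
  intro hmem
  obtain ⟨t, ht⟩ := Submodule.mem_span_singleton.1 hmem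
  have ht0 : t ≠ 0 := by rintro rfl; exact (Hα a₁ ha₁).1 (by rw [← ht, zero_smul])
  apply h12
  apply mem_span_of_colType_eq hm hn
  apply Submodule.map_injective_of_injective (f := (e : Tuple n m →ₗ[ℂ] Tuple n m)) e.injective
  rw [(Hα a₁ ha₁).2, (Hα a₂ ha₂).2, colType, colType, ← ht,
    Submodule.span_singleton_smul_eq (isUnit_iff_ne_zero.2 ht0)]

/-- The row label separates lines: `b₁ ∉ ℂb₂ ⇒ β b₁ ∉ ℂ β b₂`. [cite: MakamWigderson2021, Thm 1.13 (proof, elementary route: step D1)] -/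
theorem label_not_mem_span_row (hm : 1 ≤ m) (hn : 1 ≤ n) {β : (Fin n → ℂ) → (Fin n → ℂ)}
    (Hβ : ∀ b, b ≠ 0 → β b ≠ 0 ∧
      (rowType m b).map (e : Tuple n m →ₗ[ℂ] Tuple n m) = rowType m (β b))
    {b₁ b₂ : Fin n → ℂ} (hb₁ : b₁ ≠ 0) (hb₂ : b₂ ≠ 0) (h12 : b₁ ∉ (ℂ ∙ b₂)) :
    β b₁ ∉ (ℂ ∙ β b₂) := by
  intro hmem
  obtain ⟨t, ht⟩ := Submodule.mem_span_singleton.1 hmem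
  have ht0 : t ≠ 0 := by rintro rfl; exact (Hβ b₁ hb₁).1 (by rw [← ht, zero_smul])
  apply h12
  apply mem_span_of_rowType_eq hm hn
  apply Submodule.map_injective_of_injective (f := (e : Tuple n m →ₗ[ℂ] Tuple n m)) e.injective
  rw [(Hβ b₁ hb₁).2, (Hβ b₂ hb₂).2, rowType, rowType, ← ht,
    Submodule.span_singleton_smul_eq (isUnit_iff_ne_zero.2 ht0)]

/-- **The `L`-family.** For nonzero `a, b`: `e(c ⊗ abᵀ) = L_{ab}(c) ⊗ α(a)β(b)ᵀ` with `L_{ab}`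
linear injective (a total choice, junk at zero vectors). [cite: MakamWigderson2021, Thm 1.13 (proof, elementary route: step D2)] -/
theorem exists_Lfamily {α β : (Fin n → ℂ) → (Fin n → ℂ)}
    (Hα : ∀ a, a ≠ 0 → α a ≠ 0 ∧
      (colType m a).map (e : Tuple n m →ₗ[ℂ] Tuple n m) = colType m (α a))
    (Hβ : ∀ b, b ≠ 0 → β b ≠ 0 ∧
      (rowType m b).map (e : Tuple n m →ₗ[ℂ] Tuple n m) = rowType m (β b)) :
    ∃ Lf : (Fin n → ℂ) → (Fin n → ℂ) → ((Fin m → ℂ) →ₗ[ℂ] (Fin m → ℂ)),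
      ∀ a b, a ≠ 0 → b ≠ 0 → Function.Injective (Lf a b) ∧
        ∀ c : Fin m → ℂ, e (fun i => c i • vecMulVec a b) =
          fun i => Lf a b c i • vecMulVec (α a) (β b) := by
  classical
  have key : ∀ a b : Fin n → ℂ, ∃ L : (Fin m → ℂ) →ₗ[ℂ] (Fin m → ℂ), a ≠ 0 → b ≠ 0 →
      Function.Injective L ∧ ∀ c : Fin m → ℂ, e (fun i => c i • vecMulVec a b) =
        fun i => L c i • vecMulVec (α a) (β b) := by
    intro a b
    by_cases ha : a = 0
    · exact ⟨0, fun h => absurd ha h⟩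
    by_cases hb : b = 0
    · exact ⟨0, fun _ h => absurd hb h⟩
    obtain ⟨L, hL⟩ := exists_linear_of_map_tupleOf_span e (vecMulVec_ne_zero ha hb)
      (vecMulVec_ne_zero (Hα a ha).1 (Hβ b hb).1)
      (map_rankOnePlane e ha (Hα a ha).1 (Hα a ha).2 (Hβ b hb).2)
    exact ⟨L, fun _ _ => hL⟩
  choose Lf hLf using key
  exact ⟨Lf, hLf⟩

/-- Row-side coefficient identity: from the three formulas for `b₁, b₂, b₁ + b₂` (same `a`),
`L₁ ∝ L₂` when `β b₁ ∉ ℂ β b₂`. [cite: MakamWigderson2021, Thm 1.13 (proof, elementary route: step D3)] -/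
theorem exists_eq_smul_row (hm : 1 ≤ m) {a a' b₁ b₂ b₁' b₂' b₃' : Fin n → ℂ}
    {L₁ L₂ L₃ : (Fin m → ℂ) →ₗ[ℂ] (Fin m → ℂ)} (h₂ : Function.Injective L₂)
    (h₃ : Function.Injective L₃) (ha' : a' ≠ 0) (hb₂' : b₂' ≠ 0) (h12 : b₁' ∉ (ℂ ∙ b₂'))
    (hf₁ : ∀ c : Fin m → ℂ, e (fun i => c i • vecMulVec a b₁) = fun i => L₁ c i • vecMulVec a' b₁')
    (hf₂ : ∀ c : Fin m → ℂ, e (fun i => c i • vecMulVec a b₂) = fun i => L₂ c i • vecMulVec a' b₂')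
    (hf₃ : ∀ c : Fin m → ℂ, e (fun i => c i • vecMulVec a (b₁ + b₂)) =
      fun i => L₃ c i • vecMulVec a' b₃') :
    ∃ r : ℂ, L₁ = r • L₂ := by
  obtain ⟨x, hx⟩ := exists_dotProduct_eq_one' ha'
  refine exists_eq_smul_of_identity hm h₂ h₃ (u₃ := b₃') hb₂' h12 fun c i => ?_
  have hsum : (fun i => c i • vecMulVec a (b₁ + b₂)) =
      (fun i => c i • vecMulVec a b₁) + fun i => c i • vecMulVec a b₂ := by
    funext i; simp only [vecMulVec_add, smul_add, Pi.add_apply]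
  have h := hf₃ c
  rw [hsum, map_add, hf₁ c, hf₂ c] at h
  have hi := congrArg (fun M : Matrix (Fin n) (Fin n) ℂ => x ᵥ* M) (congrFun h i)
  simp only [Pi.add_apply, vecMul_add, vecMul_smul, vecMul_vecMulVec, hx, one_smul] at hi
  exact hi.symm

/-- Column-side coefficient identity: from the three formulas for `a₁, a₂, a₁ + a₂` (same `b`),
`L₁ ∝ L₂` when `α a₁ ∉ ℂ α a₂`. [cite: MakamWigderson2021, Thm 1.13 (proof, elementary route: step D3)] -/
theorem exists_eq_smul_col (hm : 1 ≤ m) {b b' a₁ a₂ a₁' a₂' a₃' : Fin n → ℂ}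
    {L₁ L₂ L₃ : (Fin m → ℂ) →ₗ[ℂ] (Fin m → ℂ)} (h₂ : Function.Injective L₂)
    (h₃ : Function.Injective L₃) (hb' : b' ≠ 0) (ha₂' : a₂' ≠ 0) (h12 : a₁' ∉ (ℂ ∙ a₂'))
    (hf₁ : ∀ c : Fin m → ℂ, e (fun i => c i • vecMulVec a₁ b) = fun i => L₁ c i • vecMulVec a₁' b')
    (hf₂ : ∀ c : Fin m → ℂ, e (fun i => c i • vecMulVec a₂ b) = fun i => L₂ c i • vecMulVec a₂' b')
    (hf₃ : ∀ c : Fin m → ℂ, e (fun i => c i • vecMulVec (a₁ + a₂) b) =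
      fun i => L₃ c i • vecMulVec a₃' b') :
    ∃ r : ℂ, L₁ = r • L₂ := by
  obtain ⟨y, hy⟩ := exists_dotProduct_eq_one hb'
  refine exists_eq_smul_of_identity hm h₂ h₃ (u₃ := a₃') ha₂' h12 fun c i => ?_
  have hsum : (fun i => c i • vecMulVec (a₁ + a₂) b) =
      (fun i => c i • vecMulVec a₁ b) + fun i => c i • vecMulVec a₂ b := by
    funext i; simp only [add_vecMulVec, smul_add, Pi.add_apply]
  have h := hf₃ c
  rw [hsum, map_add, hf₁ c, hf₂ c] at h
  have hi := congrArg (fun M : Matrix (Fin n) (Fin n) ℂ => M *ᵥ y) (congrFun h i)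
  simp only [Pi.add_apply, add_mulVec, smul_mulVec, vecMulVec_mulVec_eq_smul, hy,
    one_smul] at hi
  exact hi.symm

/-- **All `L_{ab}` with the same `a` are proportional** (`n ≥ 2`; a parallel pair is joined
through a third direction). [cite: MakamWigderson2021, Thm 1.13 (proof, elementary route: step D3)] -/
theorem exists_eq_smul_row_all (hn : 2 ≤ n) (hm : 1 ≤ m) {α β : (Fin n → ℂ) → (Fin n → ℂ)}
    (Hα : ∀ a, a ≠ 0 → α a ≠ 0 ∧
      (colType m a).map (e : Tuple n m →ₗ[ℂ] Tuple n m) = colType m (α a))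
    (Hβ : ∀ b, b ≠ 0 → β b ≠ 0 ∧
      (rowType m b).map (e : Tuple n m →ₗ[ℂ] Tuple n m) = rowType m (β b))
    {Lf : (Fin n → ℂ) → (Fin n → ℂ) → ((Fin m → ℂ) →ₗ[ℂ] (Fin m → ℂ))}
    (hLf : ∀ a b, a ≠ 0 → b ≠ 0 → Function.Injective (Lf a b) ∧
      ∀ c : Fin m → ℂ, e (fun i => c i • vecMulVec a b) =
        fun i => Lf a b c i • vecMulVec (α a) (β b))
    {a b₁ b₂ : Fin n → ℂ} (ha : a ≠ 0) (hb₁ : b₁ ≠ 0) (hb₂ : b₂ ≠ 0) :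
    ∃ r : ℂ, Lf a b₁ = r • Lf a b₂ := by
  have hn1 : 1 ≤ n := by omega
  have direct : ∀ b₁ b₂ : Fin n → ℂ, b₁ ≠ 0 → b₂ ≠ 0 → b₁ ∉ (ℂ ∙ b₂) →
      ∃ r : ℂ, Lf a b₁ = r • Lf a b₂ := by
    intro b₁ b₂ hb₁ hb₂ h12
    have hb₃ : b₁ + b₂ ≠ 0 := by
      intro h
      apply h12
      rw [eq_neg_of_add_eq_zero_left h]
      exact Submodule.neg_mem _ (Submodule.mem_span_singleton_self b₂)
    exact exists_eq_smul_row hm (hLf a b₂ ha hb₂).1 (hLf a (b₁ + b₂) ha hb₃).1 (Hα a ha).1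
      (Hβ b₂ hb₂).1 (label_not_mem_span_row hm hn1 Hβ hb₁ hb₂ h12) (hLf a b₁ ha hb₁).2
      (hLf a b₂ ha hb₂).2 (hLf a (b₁ + b₂) ha hb₃).2
  by_cases h12 : b₁ ∈ (ℂ ∙ b₂)
  · obtain ⟨u, hu⟩ := exists_not_mem_span hn b₂
    have hu0 : u ≠ 0 := by rintro rfl; exact hu (Submodule.zero_mem _)
    have h1u : b₁ ∉ (ℂ ∙ u) := by
      intro h
      obtain ⟨s, hs⟩ := Submodule.mem_span_singleton.1 h12
      obtain ⟨t, ht⟩ := Submodule.mem_span_singleton.1 h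
      have ht0 : t ≠ 0 := by rintro rfl; exact hb₁ (by rw [← ht, zero_smul])
      apply hu
      rw [Submodule.mem_span_singleton]
      exact ⟨t⁻¹ * s, by rw [mul_smul, hs, ← ht, smul_smul, inv_mul_cancel₀ ht0, one_smul]⟩
    obtain ⟨r₁, hr₁⟩ := direct b₁ u hb₁ hu0 h1u
    obtain ⟨r₂, hr₂⟩ := direct u b₂ hu0 hb₂ hu
    exact ⟨r₁ * r₂, by rw [hr₁, hr₂, smul_smul]⟩
  · exact direct b₁ b₂ hb₁ hb₂ h12

/-- **All `L_{ab}` with the same `b` are proportional** (`n ≥ 2`). [cite: MakamWigderson2021, Thm 1.13 (proof, elementary route: step D3)] -/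
theorem exists_eq_smul_col_all (hn : 2 ≤ n) (hm : 1 ≤ m) {α β : (Fin n → ℂ) → (Fin n → ℂ)}
    (Hα : ∀ a, a ≠ 0 → α a ≠ 0 ∧
      (colType m a).map (e : Tuple n m →ₗ[ℂ] Tuple n m) = colType m (α a))
    (Hβ : ∀ b, b ≠ 0 → β b ≠ 0 ∧
      (rowType m b).map (e : Tuple n m →ₗ[ℂ] Tuple n m) = rowType m (β b))
    {Lf : (Fin n → ℂ) → (Fin n → ℂ) → ((Fin m → ℂ) →ₗ[ℂ] (Fin m → ℂ))}
    (hLf : ∀ a b, a ≠ 0 → b ≠ 0 → Function.Injective (Lf a b) ∧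
      ∀ c : Fin m → ℂ, e (fun i => c i • vecMulVec a b) =
        fun i => Lf a b c i • vecMulVec (α a) (β b))
    {b a₁ a₂ : Fin n → ℂ} (hb : b ≠ 0) (ha₁ : a₁ ≠ 0) (ha₂ : a₂ ≠ 0) :
    ∃ r : ℂ, Lf a₁ b = r • Lf a₂ b := by
  have hn1 : 1 ≤ n := by omega
  have direct : ∀ a₁ a₂ : Fin n → ℂ, a₁ ≠ 0 → a₂ ≠ 0 → a₁ ∉ (ℂ ∙ a₂) →
      ∃ r : ℂ, Lf a₁ b = r • Lf a₂ b := by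
    intro a₁ a₂ ha₁ ha₂ h12
    have ha₃ : a₁ + a₂ ≠ 0 := by
      intro h
      apply h12
      rw [eq_neg_of_add_eq_zero_left h]
      exact Submodule.neg_mem _ (Submodule.mem_span_singleton_self a₂)
    exact exists_eq_smul_col hm (hLf a₂ b ha₂ hb).1 (hLf (a₁ + a₂) b ha₃ hb).1 (Hβ b hb).1
      (Hα a₂ ha₂).1 (label_not_mem_span_col hm hn1 Hα ha₁ ha₂ h12) (hLf a₁ b ha₁ hb).2
      (hLf a₂ b ha₂ hb).2 (hLf (a₁ + a₂) b ha₃ hb).2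
  by_cases h12 : a₁ ∈ (ℂ ∙ a₂)
  · obtain ⟨u, hu⟩ := exists_not_mem_span hn a₂
    have hu0 : u ≠ 0 := by rintro rfl; exact hu (Submodule.zero_mem _)
    have h1u : a₁ ∉ (ℂ ∙ u) := by
      intro h
      obtain ⟨s, hs⟩ := Submodule.mem_span_singleton.1 h12
      obtain ⟨t, ht⟩ := Submodule.mem_span_singleton.1 h
      have ht0 : t ≠ 0 := by rintro rfl; exact ha₁ (by rw [← ht, zero_smul])
      apply hu
      rw [Submodule.mem_span_singleton]
      exact ⟨t⁻¹ * s, by rw [mul_smul, hs, ← ht, smul_smul, inv_mul_cancel₀ ht0, one_smul]⟩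
    obtain ⟨r₁, hr₁⟩ := direct a₁ u ha₁ hu0 h1u
    obtain ⟨r₂, hr₂⟩ := direct u a₂ hu0 ha₂ hu
    exact ⟨r₁ * r₂, by rw [hr₁, hr₂, smul_smul]⟩
  · exact direct a₁ a₂ ha₁ ha₂ h12

end Extraction

/-! ### Step D2–D3: the tensor decomposition `e = L ⊗ h` of a type-preserving automorphism -/

/-- **Tensor decomposition.** A type-preserving linear automorphism `e` of `Mat_n^m = ℂ^m ⊗ M_n(ℂ)`
(`n ≥ 2`, `m ≥ 1`) is `c ⊗ A ↦ L(c) ⊗ h(A)` with `L`, `h` linear injective, and `h` maps every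
rank-one matrix `abᵀ` into the line `ℂ α(a)β(b)ᵀ` of the labels.
[cite: MakamWigderson2021, Thm 1.13 (proof, elementary route: steps D2–D3)] -/
theorem exists_tensor_decomposition (hn : 2 ≤ n) (hm : 1 ≤ m) (e : Tuple n m ≃ₗ[ℂ] Tuple n m)
    (hTP : TypePreserving e) :
    ∃ (L : (Fin m → ℂ) →ₗ[ℂ] (Fin m → ℂ))
      (h : Matrix (Fin n) (Fin n) ℂ →ₗ[ℂ] Matrix (Fin n) (Fin n) ℂ)
      (α β : (Fin n → ℂ) → (Fin n → ℂ)),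
      Function.Injective L ∧ Function.Injective h ∧
      (∀ (c : Fin m → ℂ) (A : Matrix (Fin n) (Fin n) ℂ),
        e (fun i => c i • A) = fun i => L c i • h A) ∧
      (∀ a, a ≠ 0 → α a ≠ 0) ∧ (∀ b, b ≠ 0 → β b ≠ 0) ∧
      ∀ a b, a ≠ 0 → b ≠ 0 → ∃ t : ℂ, h (vecMulVec a b) = t • vecMulVec (α a) (β b) := by
  classical
  have hn1 : 1 ≤ n := by omega
  obtain ⟨α, β, Hα, Hβ⟩ := exists_labels e hm hn1 hTP
  obtain ⟨Lf, hLf⟩ := exists_Lfamily Hα Hβ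
  -- reference vector `a₀ = (1,…,1)` and `L := L_{a₀a₀}`
  obtain ⟨a₀, ha₀⟩ : ∃ a₀ : Fin n → ℂ, a₀ ≠ 0 :=
    ⟨fun _ => 1, fun h => one_ne_zero (congrFun h ⟨0, hn1⟩)⟩
  obtain ⟨L, hLdef⟩ : ∃ L, L = Lf a₀ a₀ := ⟨_, rfl⟩
  have hLinj : Function.Injective L := by rw [hLdef]; exact (hLf a₀ a₀ ha₀ ha₀).1
  -- all `L_{ab}` are multiples of `L`
  have hprop : ∀ a b, a ≠ 0 → b ≠ 0 → ∃ r : ℂ, Lf a b = r • L := by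
    intro a b ha hb
    obtain ⟨r₁, hr₁⟩ := exists_eq_smul_row_all hn hm Hα Hβ hLf ha hb ha₀
    obtain ⟨r₂, hr₂⟩ := exists_eq_smul_col_all hn hm Hα Hβ hLf ha₀ ha ha₀
    exact ⟨r₁ * r₂, by rw [hr₁, hr₂, smul_smul, hLdef]⟩
  -- hence `e(c ⊗ abᵀ) = L(c) ⊗ (t · α(a)β(b)ᵀ)` with `t = t(a,b)`
  have HH : ∀ a b, a ≠ 0 → b ≠ 0 → ∃ t : ℂ, ∀ c : Fin m → ℂ,
      e (fun i => c i • vecMulVec a b) = fun i => L c i • (t • vecMulVec (α a) (β b)) := by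
    intro a b ha hb
    obtain ⟨r, hr⟩ := hprop a b ha hb
    refine ⟨r, fun c => ?_⟩
    rw [(hLf a b ha hb).2 c, hr]
    funext i
    rw [LinearMap.smul_apply, Pi.smul_apply, smul_eq_mul, smul_smul, mul_comm]
  -- the factor `h`: read off one nonvanishing coordinate of `L(c₁)`
  obtain ⟨c₁, hc₁, hc₁one⟩ : ∃ c₁ : Fin m → ℂ, c₁ ≠ 0 ∧ c₁ ⟨0, hm⟩ = 1 :=
    ⟨fun _ => 1, fun h => one_ne_zero (congrFun h ⟨0, hm⟩), rfl⟩
  have hLc₁ : L c₁ ≠ 0 := fun h => hc₁ (hLinj (by rw [h, map_zero]))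
  obtain ⟨i₁, hi₁⟩ := Function.ne_iff.1 hLc₁
  let T : Matrix (Fin n) (Fin n) ℂ →ₗ[ℂ] Tuple n m := LinearMap.pi fun j => c₁ j • LinearMap.id
  let h : Matrix (Fin n) (Fin n) ℂ →ₗ[ℂ] Matrix (Fin n) (Fin n) ℂ :=
    (L c₁ i₁)⁻¹ • ((LinearMap.proj i₁ : Tuple n m →ₗ[ℂ] Matrix (Fin n) (Fin n) ℂ) ∘ₗ
      (e : Tuple n m →ₗ[ℂ] Tuple n m) ∘ₗ T)
  have hh : ∀ A, h A = (L c₁ i₁)⁻¹ • e (fun j => c₁ j • A) i₁ := fun A => rfl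
  -- `h` on rank-one matrices
  have hrk : ∀ a b, a ≠ 0 → b ≠ 0 → ∀ t : ℂ,
      (∀ c : Fin m → ℂ, e (fun i => c i • vecMulVec a b) =
        fun i => L c i • (t • vecMulVec (α a) (β b))) →
      h (vecMulVec a b) = t • vecMulVec (α a) (β b) := by
    intro a b ha hb t ht
    rw [hh, ht c₁]
    dsimp only
    rw [smul_smul, inv_mul_cancel₀ hi₁, one_smul]
  -- the decomposition on all of `M_n(ℂ)` (rank-one matrices span)
  have hdec : ∀ (c : Fin m → ℂ) (A : Matrix (Fin n) (Fin n) ℂ),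
      e (fun i => c i • A) = fun i => L c i • h A := by
    intro c
    let F : Matrix (Fin n) (Fin n) ℂ →ₗ[ℂ] Tuple n m :=
      (e : Tuple n m →ₗ[ℂ] Tuple n m) ∘ₗ LinearMap.pi fun j => c j • LinearMap.id
    let G : Matrix (Fin n) (Fin n) ℂ →ₗ[ℂ] Tuple n m :=
      (LinearMap.pi fun j => L c j • LinearMap.id) ∘ₗ h
    have hFG : F = G := by
      refine eq_of_eq_on_vecMulVec F G fun a b ha hb => ?_
      obtain ⟨t, ht⟩ := HH a b ha hb
      show e (fun j => c j • vecMulVec a b) = fun j => L c j • h (vecMulVec a b)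
      rw [ht c, hrk a b ha hb t ht]
    intro A
    exact congrArg (fun F : Matrix (Fin n) (Fin n) ℂ →ₗ[ℂ] Tuple n m => F A) hFG
  have hhinj : Function.Injective h := by
    rw [injective_iff_map_eq_zero]
    intro A hA
    have h0 : e (fun j => c₁ j • A) = 0 := by
      rw [hdec c₁ A, hA]; funext j; simp
    rw [e.map_eq_zero_iff] at h0
    have := congrFun h0 ⟨0, hm⟩
    rwa [hc₁one, one_smul] at this
  refine ⟨L, h, α, β, hLinj, hhinj, hdec, fun a ha => (Hα a ha).1, fun b hb => (Hβ b hb).1,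
    fun a b ha hb => ?_⟩
  obtain ⟨t, ht⟩ := HH a b ha hb
  exact ⟨t, hrk a b ha hb t ht⟩

/-! ### Step D4: two-sided rank-one preservers of `M_n(ℂ)` are `A ↦ UAWᵀ` -/

/-- **Two-sided rank-one preservers.** An injective linear `h` on `M_n(ℂ)` with
`h(abᵀ) ∈ ℂ α(a)β(b)ᵀ` for label maps `α, β` (nonzero on nonzero vectors) is `A ↦ UAWᵀ` with
`U, W ∈ GL_n`. [cite: MakamWigderson2021, Thm 1.13 (proof, elementary route: step D4)] -/
theorem exists_eq_mul_mul_transpose (hn : 1 ≤ n)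
    (h : Matrix (Fin n) (Fin n) ℂ →ₗ[ℂ] Matrix (Fin n) (Fin n) ℂ) (hinj : Function.Injective h)
    (α β : (Fin n → ℂ) → (Fin n → ℂ)) (hα : ∀ a, a ≠ 0 → α a ≠ 0) (hβ : ∀ b, b ≠ 0 → β b ≠ 0)
    (hrk : ∀ a b, a ≠ 0 → b ≠ 0 → ∃ t : ℂ, h (vecMulVec a b) = t • vecMulVec (α a) (β b)) :
    ∃ U W : Matrix (Fin n) (Fin n) ℂ, IsUnit U ∧ IsUnit W ∧ ∀ A, h A = U * A * Wᵀ := by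
  classical
  -- the scalars in `hrk` are nonzero
  have hrk' : ∀ a b, a ≠ 0 → b ≠ 0 →
      ∃ t : ℂ, t ≠ 0 ∧ h (vecMulVec a b) = t • vecMulVec (α a) (β b) := by
    intro a b ha hb
    obtain ⟨t, ht⟩ := hrk a b ha hb
    refine ⟨t, ?_, ht⟩
    rintro rfl
    rw [zero_smul] at ht
    exact vecMulVec_ne_zero ha hb (hinj (by rw [ht, map_zero]))
  -- dot-product partners of the row labels
  have hy : ∀ b : Fin n → ℂ, ∃ y : Fin n → ℂ, b ≠ 0 → β b ⬝ᵥ y = 1 := by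
    intro b
    by_cases hb : b = 0
    · exact ⟨0, fun h => absurd hb h⟩
    obtain ⟨y, hy⟩ := exists_dotProduct_eq_one (hβ b hb)
    exact ⟨y, fun _ => hy⟩
  choose y hy using hy
  -- the column maps `U_b : a ↦ h(abᵀ) y_b`
  let Ub : (Fin n → ℂ) → (Fin n → ℂ) →ₗ[ℂ] (Fin n → ℂ) := fun b =>
    { toFun := fun a => h (vecMulVec a b) *ᵥ y b
      map_add' := fun a a' => by rw [add_vecMulVec, map_add, add_mulVec]
      map_smul' := fun t a => by rw [smul_vecMulVec, map_smul, smul_mulVec, RingHom.id_apply] }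
  have hUb : ∀ b a, Ub b a = h (vecMulVec a b) *ᵥ y b := fun b a => rfl
  have hUbt : ∀ a b, a ≠ 0 → b ≠ 0 → ∀ t : ℂ,
      h (vecMulVec a b) = t • vecMulVec (α a) (β b) → Ub b a = t • α a := by
    intro a b _ hb t ht
    rw [hUb, ht, smul_mulVec, vecMulVec_mulVec_eq_smul, hy b hb, one_smul]
  have hUbinj : ∀ b, b ≠ 0 → Function.Injective (Ub b) := by
    intro b hb
    rw [injective_iff_map_eq_zero]
    intro a ha0
    by_contra ha
    obtain ⟨t, ht0, ht⟩ := hrk' a b ha hb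
    rw [hUbt a b ha hb t ht] at ha0
    exact smul_ne_zero ht0 (hα a ha) ha0
  -- reference vector `v₀` and `U := U_{v₀}`
  obtain ⟨v₀, hv₀⟩ : ∃ v₀ : Fin n → ℂ, v₀ ≠ 0 :=
    ⟨fun _ => 1, fun h => one_ne_zero (congrFun h ⟨0, hn⟩)⟩
  obtain ⟨U, hUdef⟩ : ∃ U, U = Ub v₀ := ⟨_, rfl⟩
  have hUinj : Function.Injective U := by rw [hUdef]; exact hUbinj v₀ hv₀
  -- `U_b = μ_b · U` with `μ_b ≠ 0`
  have hμ : ∀ b, b ≠ 0 → ∃ μ : ℂ, μ ≠ 0 ∧ Ub b = μ • U := by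
    intro b hb
    have hmem : ∀ a, ∃ t : ℂ, Ub b a = t • U a := by
      intro a
      by_cases ha : a = 0
      · exact ⟨0, by rw [ha, map_zero, map_zero, smul_zero]⟩
      obtain ⟨t, -, ht⟩ := hrk' a b ha hb
      obtain ⟨t₀, ht₀0, ht₀⟩ := hrk' a v₀ ha hv₀
      refine ⟨t * t₀⁻¹, ?_⟩
      rw [hUbt a b ha hb t ht, hUdef, hUbt a v₀ ha hv₀ t₀ ht₀, smul_smul, mul_assoc,
        inv_mul_cancel₀ ht₀0, mul_one]
    obtain ⟨μ, hμ⟩ := exists_eq_smul_of_forall_apply_mem U (Ub b) hUinj hmem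
    refine ⟨μ, ?_, hμ⟩
    rintro rfl
    rw [zero_smul] at hμ
    have hi := hUbinj b hb
    rw [hμ] at hi
    exact hv₀ (hi (by rw [LinearMap.zero_apply, LinearMap.zero_apply]))
  choose μ hμ0 hμ using hμ
  -- `h(abᵀ) = (U a)(μ_b β b)ᵀ` for nonzero `a, b`
  have hform : ∀ a b, a ≠ 0 → (hb : b ≠ 0) →
      h (vecMulVec a b) = vecMulVec (U a) (μ b hb • β b) := by
    intro a b ha hb
    obtain ⟨t, -, ht⟩ := hrk' a b ha hb
    have h1 : Ub b a = t • α a := hUbt a b ha hb t ht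
    rw [hμ b hb, LinearMap.smul_apply] at h1
    rw [ht, ← smul_vecMulVec, ← h1, smul_vecMulVec, ← vecMulVec_smul]
  -- the row map `W : b ↦ x₀ᵀ h(v₀bᵀ)` with `x₀ · U v₀ = 1`
  have hUv₀ : U v₀ ≠ 0 := fun h0 => hv₀ (hUinj (by rw [h0, map_zero]))
  obtain ⟨x₀, hx₀⟩ := exists_dotProduct_eq_one' hUv₀
  let Wl : (Fin n → ℂ) →ₗ[ℂ] (Fin n → ℂ) :=
    { toFun := fun b => x₀ ᵥ* h (vecMulVec v₀ b)
      map_add' := fun b b' => by rw [vecMulVec_add, map_add, vecMul_add]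
      map_smul' := fun t b => by rw [vecMulVec_smul, map_smul, vecMul_smul, RingHom.id_apply] }
  have hWl : ∀ b, (hb : b ≠ 0) → Wl b = μ b hb • β b := by
    intro b hb
    show x₀ ᵥ* h (vecMulVec v₀ b) = _
    rw [hform v₀ b hv₀ hb, vecMul_vecMulVec, hx₀, one_smul]
  have hformW : ∀ a b, h (vecMulVec a b) = vecMulVec (U a) (Wl b) := by
    intro a b
    by_cases ha : a = 0
    · rw [ha, zero_vecMulVec, map_zero, map_zero, zero_vecMulVec]
    by_cases hb : b = 0
    · rw [hb, vecMulVec_zero, map_zero, map_zero, vecMulVec_zero]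
    rw [hform a b ha hb, hWl b hb]
  have hWinj : Function.Injective Wl := by
    rw [injective_iff_map_eq_zero]
    intro b hb0
    by_contra hb
    rw [hWl b hb] at hb0
    exact smul_ne_zero (hμ0 b hb) (hβ b hb) hb0
  -- matrices of `U` and `W`
  refine ⟨LinearMap.toMatrix' U, LinearMap.toMatrix' Wl, ?_, ?_, ?_⟩
  · rw [← Matrix.mulVec_injective_iff_isUnit]
    have : (LinearMap.toMatrix' U).mulVec = U := funext fun a => LinearMap.toMatrix'_mulVec U a
    rw [this]; exact hUinj
  · rw [← Matrix.mulVec_injective_iff_isUnit]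
    have : (LinearMap.toMatrix' Wl).mulVec = Wl :=
      funext fun b => LinearMap.toMatrix'_mulVec Wl b
    rw [this]; exact hWinj
  · let G : Matrix (Fin n) (Fin n) ℂ →ₗ[ℂ] Matrix (Fin n) (Fin n) ℂ :=
      LinearMap.mulLeft ℂ (LinearMap.toMatrix' U) ∘ₗ
        LinearMap.mulRight ℂ (LinearMap.toMatrix' Wl)ᵀ
    have hG : ∀ B, G B = LinearMap.toMatrix' U * B * (LinearMap.toMatrix' Wl)ᵀ := fun B => by
      show LinearMap.toMatrix' U * (B * (LinearMap.toMatrix' Wl)ᵀ) = _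
      rw [Matrix.mul_assoc]
    have hhG : h = G := by
      refine eq_of_eq_on_vecMulVec h G fun a b _ _ => ?_
      rw [hG, hformW, Matrix.mul_vecMulVec, Matrix.vecMulVec_mul, Matrix.vecMul_transpose,
        LinearMap.toMatrix'_mulVec, LinearMap.toMatrix'_mulVec]
    intro A
    rw [← hG, ← hhG]

/-! ### Assembly: type-preserving symmetries lie in `G_{n,m}`; swapping ones in `G_{n,m}·τ` -/

/-- **Type-preserving invertible linear maps of `Mat_n^m` lie in `G_{n,m}`** (`n ≥ 2`, `m ≥ 1`):
`g = L ⊗ (A ↦ UAWᵀ) = (X ↦ (∑ⱼ L_{ij} U Xⱼ Wᵀ)ᵢ)`.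
[cite: MakamWigderson2021, Thm 1.13 (proof, elementary route: assembly)] -/
theorem mem_G_of_typePreserving (hn : 2 ≤ n) (hm : 1 ≤ m)
    (g : LinearMap.GeneralLinearGroup ℂ (Tuple n m)) (hTP : TypePreserving g.toLinearEquiv) :
    g ∈ G n m := by
  classical
  obtain ⟨L, h, α, β, hL, hh, hdec, hα, hβ, hrk⟩ := exists_tensor_decomposition hn hm _ hTP
  obtain ⟨U, W, hU, hW, hUW⟩ := exists_eq_mul_mul_transpose (by omega) h hh α β hα hβ hrk
  have hP : IsUnit (LinearMap.toMatrix' L) := by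
    rw [← Matrix.mulVec_injective_iff_isUnit]
    have : (LinearMap.toMatrix' L).mulVec = L := funext fun c => LinearMap.toMatrix'_mulVec L c
    rw [this]; exact hL
  have hWt : IsUnit Wᵀ := (Matrix.isUnit_transpose W).2 hW
  rw [mem_G_iff]
  refine ⟨hP.unit, hU.unit, hWt.unit⁻¹, ?_⟩
  rw [inv_inv, IsUnit.unit_spec, IsUnit.unit_spec, IsUnit.unit_spec, transpose_transpose]
  apply LinearMap.ext
  intro X
  funext j
  rw [tripleAct_apply_eq_sum]
  have hX : X = ∑ i : Fin m, fun j => (Pi.single i (1 : ℂ) : Fin m → ℂ) j • X i := by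
    funext j
    rw [Finset.sum_apply]
    simp only [Pi.single_apply, ite_smul, one_smul, zero_smul, Finset.sum_ite_eq,
      Finset.mem_univ, if_true]
  have hco : ∀ Y, (g : Tuple n m →ₗ[ℂ] Tuple n m) Y = g.toLinearEquiv Y := fun Y => rfl
  calc (g : Tuple n m →ₗ[ℂ] Tuple n m) X j
      = (∑ i, (g : Tuple n m →ₗ[ℂ] Tuple n m)
          (fun j => (Pi.single i (1 : ℂ) : Fin m → ℂ) j • X i)) j := by
        conv_lhs => rw [hX]
        rw [map_sum]
    _ = ∑ i, L (Pi.single i 1) j • (U * X i * Wᵀ) := by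
        rw [Finset.sum_apply]
        refine Finset.sum_congr rfl fun i _ => ?_
        rw [hco, hdec, hUW]
    _ = ∑ i, LinearMap.toMatrix' L j i • (U * X i * Wᵀ) := by
        simp only [LinearMap.toMatrix'_apply]

/-- **A type-swapping `g` has type-preserving `gτ`** (`τ` exchanges the two families).
[cite: MakamWigderson2021, Thm 1.13 (the rôle of τ)] -/
theorem typePreserving_mul_tau {g : LinearMap.GeneralLinearGroup ℂ (Tuple n m)}
    (hTS : TypeSwapping g.toLinearEquiv) : TypePreserving (g * tau n m).toLinearEquiv := by
  have hco : ((g * tau n m).toLinearEquiv : Tuple n m →ₗ[ℂ] Tuple n m) =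
      (g.toLinearEquiv : Tuple n m →ₗ[ℂ] Tuple n m) ∘ₗ transposeMap n m := rfl
  refine ⟨fun v hv => ?_, fun w hw => ?_⟩
  · obtain ⟨v', hv', h'⟩ := hTS.2 v hv
    exact ⟨v', hv', by rw [hco, Submodule.map_comp, map_transposeMap_tupleOf_kerMat, h']⟩
  · obtain ⟨w', hw', h'⟩ := hTS.1 w hw
    exact ⟨w', hw', by rw [hco, Submodule.map_comp, map_transposeMap_tupleOf_cokerMat, h']⟩

/-- A symmetry of `S` maps `S` into `S`. [cite: MakamWigderson2021, Def. 1.10] -/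
theorem mapsTo_of_mem_symmetryGroup {S : Set (Tuple n m)}
    {g : LinearMap.GeneralLinearGroup ℂ (Tuple n m)} (hg : g ∈ symmetryGroup S) :
    Set.MapsTo g.toLinearEquiv S S := by
  rw [mem_symmetryGroup_iff] at hg
  intro X hX
  have h1 : (g : Tuple n m →ₗ[ℂ] Tuple n m) X ∈
      (fun v => (g : Tuple n m →ₗ[ℂ] Tuple n m) v) '' S := ⟨X, hX, rfl⟩
  rw [hg] at h1
  exact h1

/-- **The hard inclusion of Thm. 1.13** (`n ≥ 2`, `m ≥ 1`): `𝒢_{SING_{n,m}} ⊆ G_{n,m} ∪ G_{n,m}·τ`.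
[cite: MakamWigderson2021, Thm 1.13] -/
theorem mem_G_or_of_mem_symmetryGroup_SING (hn : 2 ≤ n) (hm : 1 ≤ m)
    {g : LinearMap.GeneralLinearGroup ℂ (Tuple n m)} (hg : g ∈ symmetryGroup (SING n m)) :
    g ∈ G n m ∨ g * tau n m ∈ G n m := by
  rcases typePreserving_or_typeSwapping hn hm (SING n m)
      (fun U hU hdim => exists_eq_tupleOf_of_finrank_eq hm U hU hdim)
      (fun v hv => tupleOf_kerMat_subset_SING hv) (fun w hw => tupleOf_cokerMat_subset_SING hw)
      g.toLinearEquiv (mapsTo_of_mem_symmetryGroup hg) with hTP | hTS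
  · exact Or.inl (mem_G_of_typePreserving hn hm g hTP)
  · exact Or.inr (mem_G_of_typePreserving hn hm _ (typePreserving_mul_tau hTS))

/-- **The hard inclusion of Thm. 1.14** (`n ≥ 2`, `m ≥ 1`): `𝒢_{NSING_{n,m}} ⊆ G_{n,m} ∪ G_{n,m}·τ`.
[cite: MakamWigderson2021, Thm 1.14] -/
theorem mem_G_or_of_mem_symmetryGroup_NSING (hn : 2 ≤ n) (hm : 1 ≤ m)
    {g : LinearMap.GeneralLinearGroup ℂ (Tuple n m)} (hg : g ∈ symmetryGroup (NSING n m)) :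
    g ∈ G n m ∨ g * tau n m ∈ G n m := by
  rcases typePreserving_or_typeSwapping hn hm (NSING n m)
      (fun U hU hdim => exists_eq_tupleOf_of_finrank_eq_NSING hm U hU hdim)
      (fun v hv => tupleOf_kerMat_subset_NSING hv) (fun w hw => tupleOf_cokerMat_subset_NSING hw)
      g.toLinearEquiv (mapsTo_of_mem_symmetryGroup hg) with hTP | hTS
  · exact Or.inl (mem_G_of_typePreserving hn hm g hTP)
  · exact Or.inr (mem_G_of_typePreserving hn hm _ (typePreserving_mul_tau hTS))

end MakamWigderson

/-! ### The discharges -/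

section Discharges

open MakamWigderson

/-- **MW 2021, Thm. 1.13, PROVED**: `𝒢_{SING_{n,m}} = G_{n,m} ∪ G_{n,m}·τ` (`n, m ≥ 1`).
[cite: MakamWigderson2021, Thm 1.13] -/
theorem makamWigderson2021_thm_1_13_holds : makamWigderson2021_thm_1_13 := by
  intro n m hn hm g
  refine ⟨fun hg => ?_, mem_symmetryGroup_SING_of_mem_G_or⟩
  rcases Nat.lt_or_ge n 2 with hn2 | hn2
  · obtain rfl : n = 1 := by omega
    exact (thm_1_13_of_n_eq_one g).1 hg
  · exact mem_G_or_of_mem_symmetryGroup_SING hn2 hm hg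

/-- **MW 2021, Thm. 1.14, PROVED**: `𝒢_{NSING_{n,m}} = G_{n,m} ∪ G_{n,m}·τ` (`n, m ≥ 1`).
[cite: MakamWigderson2021, Thm 1.14] -/
theorem makamWigderson2021_thm_1_14_holds : makamWigderson2021_thm_1_14 := by
  intro n m hn hm g
  refine ⟨fun hg => ?_, mem_symmetryGroup_NSING_of_mem_G_or⟩
  rcases Nat.lt_or_ge n 2 with hn2 | hn2
  · obtain rfl : n = 1 := by omega
    exact (thm_1_14_of_n_eq_one g).1 hg
  · exact mem_G_or_of_mem_symmetryGroup_NSING hn2 hm hg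

/-- **MW 2021, Thm. 1.9 (core), PROVED** (via Thm. 1.13 and the tree's reduction).
[cite: MakamWigderson2021, Thm 1.9] -/
theorem makamWigderson2021_thm_1_9_core_holds : makamWigderson2021_thm_1_9_core :=
  makamWigderson2021_thm_1_9_core_of_thm_1_13 makamWigderson2021_thm_1_13_holds

/-- **MW 2021, Thm. 1.8 (core), PROVED** (via Thm. 1.13 and the tree's reduction).
[cite: MakamWigderson2021, Thm 1.8] -/
theorem makamWigderson2021_thm_1_8_core_holds : makamWigderson2021_thm_1_8_core :=
  makamWigderson2021_thm_1_8_core_of_thm_1_13 makamWigderson2021_thm_1_13_holds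

end Discharges

end Literature.Computability.AlgebraicComplexity
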